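import Summits.BirchSwinnertonDyer.BirchSwinnertonDyer.Theorems.ByReductionTypeAtTwoFineSelmerConjAAtTwoAdditivePotGoodClassNumberOne780
import Summits.BirchSwinnertonDyer.BirchSwinnertonDyer.Theorems.ByReductionTypeAtTwoFineSelmerConjAAtTwoAdditivePotGoodOddDiscriminantDoor
import Summits.BirchSwinnertonDyer.BirchSwinnertonDyer.Theorems.ByReductionTypeAtTwoFineSelmerConjAAtTwoAdditivePotGoodTwoLayerDoorFukudaRows
import Summits.BirchSwinnertonDyer.BirchSwinnertonDyer.Theorems.ByReductionTypeAtTwoOrdKatoHalfAtTwoIsoConjATwoCubicModelOfClassicalMu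
import Summits.BirchSwinnertonDyer.BirchSwinnertonDyer.Theorems.ByReductionTypeAtTwoOrdKatoHalfAtTwoIsoConjATwoOfNarrowRankCertificate
import HarnessLib

/-!
# K4 crux `AdditiveRankZeroAtTwo` (19098), child C3″ `AdditivePotGoodLowerHalfAtTwo` (item 22617): the `Δ_cubic > 0` row `174920h1` (`2` SPLIT; no (A)₂ stamp so far) — (A)₂ and the BSD₂ rungs
# from a NARROW RANK CERTIFICATE of the totally real cubic point field (census instance: ONE equality
# `rank₂ Cl⁺(ℚ(θ)·ℚ₁) = rank₂ Cl⁺(ℚ(θ))`; file D of the `NarrowRankRows` series A–C; seat `bsd-2adic-k4-w2` GEN 11; `--supports stmt-BirchSwinnertonDyer-22617 --as helper`)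

Cell `bsd-2adic`. After k4-w1 GEN 9's `conjA_two_100560c1''` (one prime above `2`: Horie–Fukuda unit-signature road, kernel) six `Δ_cubic > 0` rows of the C1″ census
still carried GEN 8's print binder `hLim2` = Lim 2017 Thm. 3.5 at `2` DOWNSTAIRS at a TOTALLY REAL carrier (the RC-457 D-audit risk `LIM35@2-REAL`): `261648q1`,
`279440c1`, `293200be1`, `412992bw1`, `445508b1`, `467928d1` — all with TWO primes above `2` in the cubic field `ℚ(θ)` (`h(ℚ(θ)) = 1`), outside the one-prime doors.
cruxlead-19573-w2 GEN 9 landed NARROW FUKUDA (Literature p739601 `NarrowFukudaRankProofs`, p739895 `NarrowFukudaCertificateLayerModels`: Fukuda 1994 Thm. 1 (2) for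
NARROW class groups, finite level) and the door `NarrowRankCert.conjA_two_cubicModel_of_narrowRankCertificate` (`…OrdKatoHalfAtTwoIsoConjATwoOfNarrowRankCertificate`, ANY
sign of `Δ`): Fukuda index `n₀` on the cubic tower ∧ `[Cl⁺(layer n₀+1) : (Cl⁺)²] = [Cl⁺(layer n₀) : (Cl⁺)²]` ∧ narrow ranks bounded below layer `n₀` ⟹ narrow `μ₂ = 0` and a
narrow-defect bound ⟹ (A)₂ by GEN 8's Kida-lite ascent `NarrowMu.conjA_two_cubicModel_of_narrowMu`. This file supplies, per row (rows `174920h1`): §1 the KERNEL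
`n₀ = 0` on `ℚ(θ)` (`forall_totallyRamifiedFrom_zero_h<L>`: index witness `ω = (θ + θ²)/2`, `8 ∤ disc(θ) = 87460` ⟹ `2 ∤ d_K = 21865` (`2` unramified — it splits completely)), the general stamp `AddKatoTwo.conjA_two_<L>_of_narrowRankCert hθ n B hcert` (exact change
`θ ↔ x(P)`; any layer pair `n / n+1`) and the CENSUS INSTANCE `AddKatoTwo.conjA_two_<L>_of_narrowRankEq₀₁ hθ hnr` — (A)₂ with NO print fact from ONE displayed equality of
narrow `2`-ranks at layers `0 / 1` (= equality of the unit-signature defects `#(U⁺/U²)` of `ℚ(θ, √2)` and `ℚ(θ)`, both class numbers being odd); §2 GEN 3's rungs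
re-keyed: `AddPotGoodInstances.bsdp_two_<L>_narrowRankEq`, `bsdp_two_of_isIsogenous_<L>_narrowRankEq` — BSD₂ on the class ⟸ PRINT {hSharp (reading), hGZK, hmod, hCT(,
hCassels)} + RECORD {r_an = 0, #Ш_an = q, ord₂ q ≤ 6} + the two VALUED Selmer slots + `hnr`; `hLim2` GONE. `θ` is k4-w1's generator (`…ChevalleyStamps{A,B,C}`).

HONEST FRAMING (D-0036 / D-0054 / D-0152): conditional theorems; `hnr` is an INSTRUMENT-tier datum that is **UNVALUED** when this file lands (the cell holds no
`bnfnarrow` record for these six cubic fields and their `√2`-layers; ≈ one core-minute of PARI owed — WANTED posted on STATUS; if the layer-`0/1` narrow ranks differ,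
the general stamp takes a higher layer pair); `hSharp` is the Kato-at-`2` SHARP reading (D-audit PASS). Closes nothing at the `∀`-level (C3″ 22617 / C1″ 22615 OPEN);
nothing booked (D-0054); no rung moves; BSD is not proved by any of this. THEOREMS ONLY (no `def`).

References: [Fukuda1994] Thm. 1 (2), p. 264; [Washington1997] §13.1 Prop. 13.2, Lemma 13.3; [Kida1982JFields] main theorem (shape); [CoatesSujatha2005] (A), Thm. 3.4;
[Kato2004Asterisque] Thm. 12.5 (1)(3), 13.8, 14.14; [Cassels1965ArithmeticVIII] Thm. 1.3; [Miller2011LMS] Def. 1.1.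
-/

set_option autoImplicit false
-- the Theorems namespace of this sub repeats the summit name by design (D-0017 nested layout)
set_option linter.dupNamespace false

noncomputable section

open scoped Classical IntermediateField NumberField Real nonZeroDivisors

/-! ## Kernel `n₀ = 0` and narrow-rank stamps (namespace `AddKatoTwo`); the rungs are in `…NarrowRankRungsD` -/

namespace Summit.BirchSwinnertonDyer.BirchSwinnertonDyer.Theorems.AddKatoTwo

open WeierstrassCurve Field Polynomial IsDedekindDomain NumberField Matrix Literature.NumberTheory.EllipticCurves
  Literature.NumberTheory.GaloisRepresentations
  Literature.NumberTheory.IwasawaTheory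
  Literature.NumberTheory.NumberFields
  Summit.BirchSwinnertonDyer.BirchSwinnertonDyer.Theorems.SteinbergFibreAtTwo
  Summit.BirchSwinnertonDyer.BirchSwinnertonDyer.Theorems.AlignedTransportAtTwoTorsionPointField
  Summit.BirchSwinnertonDyer.BirchSwinnertonDyer.Theses.ByReductionTypeAtTwo

/-- **A monic integer cubic with a root `β` of degree `3` is irreducible** (restated to keep this file's imports minimal). [folklore] -/
private theorem irreducibleCubic_of_finrank_three_srnrD {p q r : ℤ} {β : AlgebraicClosure ℚ}
    (hβ : aeval β (Cubic.toPoly ⟨1, (p : ℚ), q, r⟩) = 0) (h3 : Module.finrank ℚ (IntermediateField.adjoin ℚ {β}) = 3) :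
    Irreducible (Cubic.toPoly ⟨1, (p : ℚ), q, r⟩) := by
  have hfm : (Cubic.toPoly ⟨1, (p : ℚ), q, r⟩).Monic := Cubic.monic_of_a_eq_one'
  have hβint : IsIntegral ℚ β := ⟨_, hfm, by rwa [← aeval_def]⟩
  have hdeg : (minpoly ℚ β).natDegree = (Cubic.toPoly ⟨1, (p : ℚ), q, r⟩).natDegree := by
    rw [← IntermediateField.adjoin.finrank hβint, h3, Cubic.natDegree_of_a_ne_zero' one_ne_zero]
  have heq : Cubic.toPoly ⟨1, (p : ℚ), q, r⟩ = minpoly ℚ β :=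
    Polynomial.eq_of_monic_of_dvd_of_natDegree_le (minpoly.monic hβint) hfm (minpoly.dvd ℚ β hβ) hdeg.ge
  rw [heq]
  exact minpoly.irreducible hβint

/-- **The displayed part of the `n₀ = 0` narrow rank certificate from ONE layer-`0/1` equality, for any number field `K`** (file-private helper; the bound at layer `0` is
`ord₂ [Cl⁺(K) : (Cl⁺)²]` itself by `index_range_pow_narrowClassGroup_layer_zero_eq`). Stated for a generic `K` on purpose: at the concrete point fields
`ℚ(θ) ⊂ ℚ̄` the same `rw` exhausts the `isDefEq` budget. [cite: Fukuda1994, Thm. 1 (2), p. 264] -/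
private theorem narrowRankCert_zero_of_layerEq_D (K : Type) [Field K] [NumberField K]
    (hnr : ∀ κ : ZpExtension K 2, κ.IsCyclotomic →
      ∀ [NumberField ↥(κ.layer 0)] [NumberField ↥(κ.layer 1)],
        (powMonoidHom (α := NarrowClassGroup ↥(κ.layer 1)) 2).range.index =
          (powMonoidHom (α := NarrowClassGroup ↥(κ.layer 0)) 2).range.index) :
    ∀ κ : ZpExtension K 2, κ.IsCyclotomic →
      (∀ [NumberField ↥(κ.layer 0)] [NumberField ↥(κ.layer (0 + 1))],
        (powMonoidHom (α := NarrowClassGroup ↥(κ.layer (0 + 1))) 2).range.index =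
          (powMonoidHom (α := NarrowClassGroup ↥(κ.layer 0)) 2).range.index) ∧
      (∀ m : ℕ, m ≤ 0 → ∀ [NumberField ↥(κ.layer m)],
        padicValNat 2 (powMonoidHom (α := NarrowClassGroup ↥(κ.layer m)) 2).range.index ≤
          padicValNat 2 (powMonoidHom (α := NarrowClassGroup K) 2).range.index) := by
  intro κ hκ
  refine ⟨?_, ?_⟩
  · intro i0 i1
    exact @hnr κ hκ i0 i1
  · intro m hm i
    obtain rfl : m = 0 := Nat.le_zero.mp hm
    rw [index_range_pow_narrowClassGroup_layer_zero_eq κ 2]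

/-- `X³ + (-1)X² + (-30)X + (40)` (a reduced generator of the TOTALLY REAL `2`-torsion cubic field of `174920h1`, discriminant `87460`) is irreducible over `ℚ`
(no root mod `3`). -/
theorem irreducible_cubic_h174920h1 : Irreducible (Cubic.toPoly ⟨1, ((-1 : ℤ) : ℚ), ((-30 : ℤ) : ℚ), ((40 : ℤ) : ℚ)⟩) :=
  haveI : Fact (Nat.Prime 3) := ⟨by norm_num⟩
  irreducible_cubic_of_no_root_zmod 3 (by decide)

/-- **`n₀ = 0` for `ℚ(θ)` of `174920h1`, KERNEL** (`disc(θ) = 87460 = 4·d_K`): the index witness `ω = (0 + (1)θ + (1)θ²)/2 ∈ 𝓞 ℚ(θ)`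
(`ω³ + (-31)ω² + (260)ω + (-340) = 0`, `exists_intElem_of_scaled_cubic`) and `8 ∤ disc` give `2 ∤ d_K` (k4-w1 `not_dvd_discr_of_intElem`), so `2` is
unramified and `n₀ = 0` (`totallyRamifiedFrom_zero_of_not_dvd_discr`, p687770). [cite: Fukuda1994, p. 264 (the index `n₀`)] [cite: Washington1997, §13.1 Lemma 13.3] -/
theorem forall_totallyRamifiedFrom_zero_h174920h1
    {θ : AlgebraicClosure ℚ} (hθ : aeval θ (Cubic.toPoly ⟨1, ((-1 : ℤ) : ℚ), ((-30 : ℤ) : ℚ), ((40 : ℤ) : ℚ)⟩) = 0)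
    :
    haveI : FiniteDimensional ℚ (IntermediateField.adjoin ℚ {θ}) :=
      IntermediateField.adjoin.finiteDimensional ((AlgebraicClosure.isAlgebraic ℚ).isAlgebraic θ).isIntegral
    haveI : NumberField (IntermediateField.adjoin ℚ {θ}) := NumberField.mk
    ∀ κL : ZpExtension (IntermediateField.adjoin ℚ {θ}) 2, κL.IsCyclotomic → TotallyRamifiedFrom κL 0 := by
  haveI : FiniteDimensional ℚ (IntermediateField.adjoin ℚ {θ}) :=
    IntermediateField.adjoin.finiteDimensional ((AlgebraicClosure.isAlgebraic ℚ).isAlgebraic θ).isIntegral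
  haveI : NumberField (IntermediateField.adjoin ℚ {θ}) := NumberField.mk
  have hirr := irreducible_cubic_h174920h1
  have h3 := finrank_adjoin_eq_three_of_irreducible hirr hθ
  obtain ⟨B, -, hB⟩ := exists_ringOfIntegers_cubic_root (p := -1) (q := -30) (r := 40) hθ
  obtain ⟨ω, hω, -⟩ := exists_intElem_of_scaled_cubic _ B (0) (1) (1) (m := 2) (by norm_num) (-31) (260) (-340)
    (by push_cast; linear_combination (((-68 : ℤ) : 𝓞 (IntermediateField.adjoin ℚ {θ})) + ((-25 : ℤ) : 𝓞 (IntermediateField.adjoin ℚ {θ})) * B + ((4 : ℤ) : 𝓞 (IntermediateField.adjoin ℚ {θ})) * B ^ 2 + ((1 : ℤ) : 𝓞 (IntermediateField.adjoin ℚ {θ})) * B ^ 3) * hB)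
  have hodd : ¬ ((2 : ℤ) ∣ NumberField.discr (IntermediateField.adjoin ℚ {θ})) := by
    have := not_dvd_discr_of_intElem _ h3 B hirr hB Nat.prime_two (0) (1) (1) ⟨ω, hω⟩ (by norm_num)
      (by simp only [Cubic.discr]; norm_num)
    exact_mod_cast this
  exact fun κL hκL => totallyRamifiedFrom_zero_of_not_dvd_discr (by rw [h3]; norm_num) hodd κL hκL

/-- **(A)₂ for `174920h1` from a NARROW RANK CERTIFICATE of the totally real cubic point field, NO print fact** (`d = 21865`, `2` SPLITS COMPLETELY in `ℚ(θ)` (three primes above `2`), `h = 1`; ordinary tower ranks 0 / 1 / 1 / 1 (kit j301920) — the census row with NO (A)₂ stamp before this file): `θ` any root of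
`X³ + (-1)X² + (-30)X + (40)` (`ℚ(P) = ℚ(β) = ℚ(θ)`, `β = x(P) = -752028 + (294445/2)θ + (69143/2)θ²` a root of the `2`-division cubic — exact change of
generator); displayed, for a layer index `n` and a bound `B`: along every cyclotomic `ℤ₂`-extension of `ℚ(θ)`, `[Cl⁺(layer n+1) : (Cl⁺)²] = [Cl⁺(layer n) : (Cl⁺)²]`
and `ord₂ [Cl⁺(layer m) : (Cl⁺)²] ≤ B` for `m ≤ n` (narrow `2`-ranks; instrument). KERNEL: `n₀ = 0` on the cubic field (`forall_totallyRamifiedFrom_zero_h174920h1`,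
monotone to `n`), cruxlead-19573-w2's NARROW FUKUDA + Kida-lite ascent `NarrowRankCert.conjA_two_cubicModel_of_narrowRankCertificate` (any sign of `Δ`).
No `hLim2` (the LIM35@2-REAL print binder of GEN 8's `conjA_two_174920h1` is not used). BSD for `174920h1` is NOT proved by this.
[cite: Fukuda1994, Thm. 1 (2), p. 264] [cite: CoatesSujatha2005, Conj. A and Thm. 3.4] [cite: Kida1982JFields, main theorem (μ-part; shape only)] -/
theorem conjA_two_174920h1_of_narrowRankCert
    {θ : AlgebraicClosure ℚ} (hθ : aeval θ (Cubic.toPoly ⟨1, ((-1 : ℤ) : ℚ), ((-30 : ℤ) : ℚ), ((40 : ℤ) : ℚ)⟩) = 0)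
    (n B : ℕ)
    (hcert : haveI : FiniteDimensional ℚ (IntermediateField.adjoin ℚ {θ}) :=
        IntermediateField.adjoin.finiteDimensional ((AlgebraicClosure.isAlgebraic ℚ).isAlgebraic θ).isIntegral
      haveI : NumberField (IntermediateField.adjoin ℚ {θ}) := NumberField.mk
      ∀ κL : ZpExtension (IntermediateField.adjoin ℚ {θ}) 2, κL.IsCyclotomic →
        (∀ [NumberField ↥(κL.layer n)] [NumberField ↥(κL.layer (n + 1))],
          (powMonoidHom (α := NarrowClassGroup ↥(κL.layer (n + 1))) 2).range.index =
            (powMonoidHom (α := NarrowClassGroup ↥(κL.layer n)) 2).range.index) ∧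
        (∀ m : ℕ, m ≤ n → ∀ [NumberField ↥(κL.layer m)],
          padicValNat 2 (powMonoidHom (α := NarrowClassGroup ↥(κL.layer m)) 2).range.index ≤ B))
    (κ : ZpExtension ℚ 2) (hκ : κ.IsCyclotomic) :
    haveI := (isElliptic_cubicModel _ _ _ (by simp only [Cubic.discr]; norm_num) : (⟨0, ((0 : ℤ) : ℚ), 0, ((-717514194247 : ℤ) : ℚ), ((-233934275882300614 : ℤ) : ℚ)⟩ : WeierstrassCurve ℚ).IsElliptic)
    ∃ (γ : absoluteGaloisGroup ℚ) (D : (⟨0, ((0 : ℤ) : ℚ), 0, ((-717514194247 : ℤ) : ℚ), ((-233934275882300614 : ℤ) : ℚ)⟩ : WeierstrassCurve ℚ).FineSelmerDualData κ γ),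
      Module.Finite ℤ_[2] (RestrictScalars ℤ_[2] (IwasawaAlgebra 2) D.X) := by
  haveI := (isElliptic_cubicModel _ _ _ (by simp only [Cubic.discr]; norm_num) : (⟨0, ((0 : ℤ) : ℚ), 0, ((-717514194247 : ℤ) : ℚ), ((-233934275882300614 : ℤ) : ℚ)⟩ : WeierstrassCurve ℚ).IsElliptic)
  have hθ' : θ ^ 3 + (-1 : AlgebraicClosure ℚ) * θ ^ 2 + (-30 : AlgebraicClosure ℚ) * θ + (40 : AlgebraicClosure ℚ) = 0 := by
    have := hθ
    simp only [Cubic.toPoly, map_one, one_mul, aeval_add, aeval_mul, aeval_C, aeval_X_pow, aeval_X,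
      eq_ratCast, Rat.cast_intCast] at this
    push_cast at this
    linear_combination this
  obtain ⟨β, hβdef⟩ : ∃ β : AlgebraicClosure ℚ, β = algebraMap ℚ (AlgebraicClosure ℚ) (-752028 : ℚ) +
      algebraMap ℚ (AlgebraicClosure ℚ) (294445 / 2 : ℚ) * θ + algebraMap ℚ (AlgebraicClosure ℚ) (69143 / 2 : ℚ) * θ ^ 2 := ⟨_, rfl⟩
  have hβ : aeval β (Cubic.toPoly ⟨1, ((0 : ℤ) : ℚ), ((-717514194247 : ℤ) : ℚ), ((-233934275882300614 : ℤ) : ℚ)⟩) = 0 := by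
    simp only [Cubic.toPoly, map_one, one_mul, aeval_add, aeval_mul, aeval_C, aeval_X_pow, aeval_X, eq_ratCast,
      Rat.cast_intCast]
    rw [hβdef]
    simp only [eq_ratCast]
    push_cast
    linear_combination (((-11965002351584365 : AlgebraicClosure ℚ) / 4) + ((10882317333723125 : AlgebraicClosure ℚ) / 8) * θ + ((2276781718037311 : AlgebraicClosure ℚ) / 4) * θ ^ 2 + ((330555704867207 : AlgebraicClosure ℚ) / 8) * θ ^ 3) * hθ'
  have hadj : IntermediateField.adjoin ℚ {β} = IntermediateField.adjoin ℚ {θ} := by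
    apply le_antisymm
    · rw [IntermediateField.adjoin_simple_le_iff, hβdef]
      have hθmem := IntermediateField.mem_adjoin_simple_self ℚ θ
      exact add_mem (add_mem (algebraMap_mem _ _) (mul_mem (algebraMap_mem _ _) hθmem))
        (mul_mem (algebraMap_mem _ _) (pow_mem hθmem 2))
    · rw [IntermediateField.adjoin_simple_le_iff]
      have hθeq : θ = algebraMap ℚ (AlgebraicClosure ℚ) (-16537027968496357 / 27331250 : ℚ) +
          algebraMap ℚ (AlgebraicClosure ℚ) (-33814489599 / 54662500 : ℚ) * β +
          algebraMap ℚ (AlgebraicClosure ℚ) (69143 / 54662500 : ℚ) * β ^ 2 := by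
        rw [hβdef]; simp only [eq_ratCast]; push_cast
        linear_combination (((-3145894192338817 : AlgebraicClosure ℚ) / 218650000) + ((-330555704867207 : AlgebraicClosure ℚ) / 218650000) * θ) * hθ'
      rw [hθeq]
      have hβmem := IntermediateField.mem_adjoin_simple_self ℚ β
      exact add_mem (add_mem (algebraMap_mem _ _) (mul_mem (algebraMap_mem _ _) hβmem))
        (mul_mem (algebraMap_mem _ _) (pow_mem hβmem 2))
  haveI : FiniteDimensional ℚ (IntermediateField.adjoin ℚ {θ}) :=
    IntermediateField.adjoin.finiteDimensional ((AlgebraicClosure.isAlgebraic ℚ).isAlgebraic θ).isIntegral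
  haveI : NumberField (IntermediateField.adjoin ℚ {θ}) := NumberField.mk
  have h3 := finrank_adjoin_eq_three_of_irreducible irreducible_cubic_h174920h1 hθ
  have h3β : Module.finrank ℚ (IntermediateField.adjoin ℚ {β}) = 3 := by rw [hadj]; exact h3
  -- transport along `ℚ(β) = ℚ(θ)` by substituting a field VARIABLE (a `rw` on this statement times out at `whnf`)
  have hcert' : ∀ F : IntermediateField ℚ (AlgebraicClosure ℚ), IntermediateField.adjoin ℚ {θ} = F →
      ∀ κL : ZpExtension ↥F 2, κL.IsCyclotomic →
      TotallyRamifiedFrom κL n ∧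
      (∀ [NumberField ↥(κL.layer n)] [NumberField ↥(κL.layer (n + 1))],
        (powMonoidHom (α := NarrowClassGroup ↥(κL.layer (n + 1))) 2).range.index =
          (powMonoidHom (α := NarrowClassGroup ↥(κL.layer n)) 2).range.index) ∧
      (∀ m : ℕ, m ≤ n → ∀ [NumberField ↥(κL.layer m)],
        padicValNat 2 (powMonoidHom (α := NarrowClassGroup ↥(κL.layer m)) 2).range.index ≤ B) :=
    by rintro F rfl; exact fun κL hκL => ⟨(forall_totallyRamifiedFrom_zero_h174920h1 hθ κL hκL).mono (Nat.zero_le n), hcert κL hκL⟩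
  exact NarrowRankCert.conjA_two_cubicModel_of_narrowRankCertificate (0) (-717514194247) (-233934275882300614)
    (irreducibleCubic_of_finrank_three_srnrD hβ h3β) hβ n B (hcert' _ hadj.symm) κ hκ

/-- **(A)₂ for `174920h1` WITHOUT any print fact — the CENSUS INSTANCE: ONE displayed equality of narrow `2`-ranks at layers `0 / 1`**, i.e.
`rank₂ Cl⁺(ℚ(θ)·ℚ₁) = rank₂ Cl⁺(ℚ(θ))` (`ℚ(θ)·ℚ₁ = ℚ(θ, √2)`, degrees `6` and `3`; for these `h`-odd fields = equality of the unit-signature defects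
`#(U⁺/U²)` at the two layers) — instrument tier, **UNVALUED at landing time** (no `bnfnarrow` record in the cell for this field; kit owed). `n = 0`, `B = ord₂ [Cl⁺(ℚ(θ)) : (Cl⁺)²]`
in `conjA_two_174920h1_of_narrowRankCert` (the layer-`0` bound is automatic by `index_range_pow_narrowClassGroup_layer_zero_eq`). Replaces the print binder `hLim2`
(LIM35@2-REAL) of GEN 8's road on this row. BSD for `174920h1` is NOT proved by this. [cite: Fukuda1994, Thm. 1 (2), p. 264] [cite: Washington1997, §13.1]
[cite: CoatesSujatha2005, Conj. A and Thm. 3.4] -/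
theorem conjA_two_174920h1_of_narrowRankEq₀₁
    {θ : AlgebraicClosure ℚ} (hθ : aeval θ (Cubic.toPoly ⟨1, ((-1 : ℤ) : ℚ), ((-30 : ℤ) : ℚ), ((40 : ℤ) : ℚ)⟩) = 0)
    (hnr : haveI : FiniteDimensional ℚ (IntermediateField.adjoin ℚ {θ}) :=
        IntermediateField.adjoin.finiteDimensional ((AlgebraicClosure.isAlgebraic ℚ).isAlgebraic θ).isIntegral
      haveI : NumberField (IntermediateField.adjoin ℚ {θ}) := NumberField.mk
      ∀ κL : ZpExtension (IntermediateField.adjoin ℚ {θ}) 2, κL.IsCyclotomic →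
        ∀ [NumberField ↥(κL.layer 0)] [NumberField ↥(κL.layer 1)],
          (powMonoidHom (α := NarrowClassGroup ↥(κL.layer 1)) 2).range.index =
            (powMonoidHom (α := NarrowClassGroup ↥(κL.layer 0)) 2).range.index)
    (κ : ZpExtension ℚ 2) (hκ : κ.IsCyclotomic) :
    haveI := (isElliptic_cubicModel _ _ _ (by simp only [Cubic.discr]; norm_num) : (⟨0, ((0 : ℤ) : ℚ), 0, ((-717514194247 : ℤ) : ℚ), ((-233934275882300614 : ℤ) : ℚ)⟩ : WeierstrassCurve ℚ).IsElliptic)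
    ∃ (γ : absoluteGaloisGroup ℚ) (D : (⟨0, ((0 : ℤ) : ℚ), 0, ((-717514194247 : ℤ) : ℚ), ((-233934275882300614 : ℤ) : ℚ)⟩ : WeierstrassCurve ℚ).FineSelmerDualData κ γ),
      Module.Finite ℤ_[2] (RestrictScalars ℤ_[2] (IwasawaAlgebra 2) D.X) := by
  haveI : FiniteDimensional ℚ (IntermediateField.adjoin ℚ {θ}) :=
    IntermediateField.adjoin.finiteDimensional ((AlgebraicClosure.isAlgebraic ℚ).isAlgebraic θ).isIntegral
  haveI : NumberField (IntermediateField.adjoin ℚ {θ}) := NumberField.mk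
  exact conjA_two_174920h1_of_narrowRankCert hθ 0 _
    (narrowRankCert_zero_of_layerEq_D _ hnr) κ hκ

end Summit.BirchSwinnertonDyer.BirchSwinnertonDyer.Theorems.AddKatoTwo

end
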